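import Mathlib.Analysis.Calculus.Deriv.MeanValue
import Mathlib.Analysis.SpecialFunctions.ExpDeriv
import Mathlib.MeasureTheory.Integral.IntervalIntegral.FundThmCalculus
import Mathlib.Topology.Order.ProjIcc
import Literature.Analysis.FluidPDE.PassiveScalarClassicalEnergy
import Literature.Analysis.FluidPDE.TorusClassicalH1Balance
import Literature.Analysis.FunctionSpaces.TorusInverseLaplacianCalculus
import Literature.Analysis.FunctionSpaces.TorusSpaceTime
import HarnessLib

/-!
# Gradient growth of passive-scalar releases under a Lipschitz drift (Poon / Miles–Doering)

Support file for the tool stub `stub_releaseGradientGrowth` of the line `budgeted-mixer-template`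
for the crux `TwoAndHalfD.ScalarAnomalySteadySourceFormal` (stmt-AnomalousDissipation-0448).
For a classical solution `φ` of `∂ₜφ + u·∇φ = κΔφ`, `div u = 0`, on `[a, b] × T^d` (`κ ≥ 0`,
`a < b`) whose drift has velocity gradient bounded in quadratic form,
`|⟪ξ, Du(t, x) ξ⟫| ≤ Λ(t) ‖ξ‖²`, the scalar enstrophy `E(t) = ‖∇φ(t)‖²_{L²}` obeys

`E(t) ≤ E(a) · exp (2 ∫ₐᵗ Λ)` for `t ∈ [a, b]`

(Poon 1996; Miles–Doering 2018; Coti Zelati–Delgadino–Elgindi 2020: the `H¹` balance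
`E' = -2κ‖Δφ‖² - 2∫ ⟪∇φ, Du ∇φ⟫`, the transport of `|∇φ|²` integrating to zero by
incompressibility, and Grönwall). Contents:

* `partialDeriv_gradient_comm` — `∂ᵢ∇θ = ∇∂ᵢθ` (Schwarz);
* `integral_inner_gradient_mul_laplacian` — `∫ ⟪u, ∇θ⟫ Δθ = -∫ ⟪∇θ, Du ∇θ⟫` for smooth
  divergence-free `u` (integrate by parts; the piece `∑ᵢ ∫ ∂ᵢθ ⟪u, ∇∂ᵢθ⟫` vanishes);
* `hasDerivWithinAt_scalarGradNormSq` — the `H¹` balance of classical passive scalars,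
  `d/dt ‖∇φ‖² = -2κ ∫ (Δφ)² - 2 ∫ ⟪∇φ, Du ∇φ⟫` within `[a, b]`;
* `scalarGradNormSq_le_mul_exp` — the gradient-growth bound (monotonicity of
  `E(t) exp(-2∫ₐᵗ Λ)`, Mathlib `antitoneOn_of_hasDerivWithinAt_nonpos`);
* `stub_releaseGradientGrowth` — the registered `∀`-form on `T²`.

Supports stmt-AnomalousDissipation-0448. [folklore: Poon 1996; Miles–Doering 2018, §2]
-/

noncomputable section

namespace Summit.AnomalousDissipation.AnomalousDissipation.Theorems.ScalarAnomalySteadySourceFormal.ReleaseGradientGrowth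

open MeasureTheory Filter Topology Set
open scoped ENNReal NNReal RealInnerProductSpace InnerProductSpace ContDiff
open Literature.Analysis.FunctionSpaces Literature.Analysis.FluidPDE

-- the summit path `AnomalousDissipation/AnomalousDissipation` duplicates a namespace component
set_option linter.dupNamespace false

variable {d : Type*} [Fintype d] [DecidableEq d]

/-! ## Two pointwise / integral identities on a single slice -/

/-- **Schwarz for the gradient**: `∂ᵢ(∇θ) = ∇(∂ᵢθ)` pointwise for a smooth scalar `θ` on `T^d`
(coordinates of the gradient are partial derivatives, `Torus.gradient_apply`, and mixed partial
derivatives commute, `Torus.partialDeriv_comm`). [folklore] -/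
theorem partialDeriv_gradient_comm {θ : UnitAddTorus d → ℝ} (hθ : Torus.IsSmooth θ) (i : d)
    (x : UnitAddTorus d) :
    Torus.partialDeriv i (Torus.gradient θ) x = Torus.gradient (Torus.partialDeriv i θ) x := by
  have hθ1 : Torus.IsContDiff 1 θ := hθ.isContDiff (by simp)
  have hg1 : Torus.IsContDiff 1 (Torus.gradient θ) := hθ.gradient.isContDiff (by simp)
  have hd1 : Torus.IsContDiff 1 (Torus.partialDeriv i θ) := (hθ.partialDeriv i).isContDiff (by simp)
  ext j
  have hfun : (fun y => Torus.gradient θ y j) = Torus.partialDeriv j θ :=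
    funext fun y => Torus.gradient_apply hθ1 y j
  rw [← Torus.partialDeriv_apply_coord hg1 i x j, Torus.gradient_apply hd1 x j,
    ← Torus.partialDeriv_comm hθ i j x, hfun]

/-- **The transport–stretching identity.** For a smooth divergence-free field `u` and a smooth
scalar `θ` on `T^d`, `∫ ⟪u, ∇θ⟫ Δθ = -∫ ⟪∇θ, Du ∇θ⟫`: integrating by parts,
`∫ ⟪u, ∇θ⟫ Δθ = -∑ᵢ ∫ ∂ᵢ⟪u, ∇θ⟫ ∂ᵢθ = -∑ᵢ ∫ ∂ᵢθ ⟪u, ∇∂ᵢθ⟫ - ∑ᵢ ∫ ∂ᵢθ ⟪∂ᵢu, ∇θ⟫`, the first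
group vanishing by incompressibility (`∫ f ⟪u, ∇f⟫ = 0` with `f = ∂ᵢθ`) and the second being
`∫ ⟪Du ∇θ, ∇θ⟫` (`Du w = ∑ᵢ wᵢ ∂ᵢu`). (Miles–Doering 2018, §2; Poon 1996.) [folklore] -/
theorem integral_inner_gradient_mul_laplacian {u : UnitAddTorus d → EuclideanSpace ℝ d}
    {θ : UnitAddTorus d → ℝ} (hu : Torus.IsSmooth u) (hdiv : Torus.IsDivFree u)
    (hθ : Torus.IsSmooth θ) :
    ∫ x, ⟪u x, Torus.gradient θ x⟫_ℝ * Torus.laplacian θ x =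
      -∫ x, ⟪Torus.gradient θ x, Torus.fderiv u x (Torus.gradient θ x)⟫_ℝ := by
  have hu1 : Torus.IsContDiff 1 u := hu.isContDiff (by simp)
  have hθ1 : Torus.IsContDiff 1 θ := hθ.isContDiff (by simp)
  have hg : Torus.IsSmooth (Torus.gradient θ) := hθ.gradient
  have hg1 : Torus.IsContDiff 1 (Torus.gradient θ) := hg.isContDiff (by simp)
  have hψ : Torus.IsSmooth (fun y => ⟪u y, Torus.gradient θ y⟫_ℝ) := hu.inner hg
  have hD : ∀ i, Torus.IsSmooth (Torus.partialDeriv i θ) := fun i => hθ.partialDeriv i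
  rw [Torus.integral_mul_laplacian_eq_neg_sum hψ hθ]
  congr 1
  -- each summand: `∫ ∂ᵢ⟪u, ∇θ⟫ ∂ᵢθ = ∫ ∂ᵢθ ⟪∂ᵢu, ∇θ⟫`
  have hterm : ∀ i, ∫ x, Torus.partialDeriv i (fun y => ⟪u y, Torus.gradient θ y⟫_ℝ) x *
      Torus.partialDeriv i θ x =
      ∫ x, Torus.partialDeriv i θ x * ⟪Torus.partialDeriv i u x, Torus.gradient θ x⟫_ℝ := by
    intro i
    have hpt : ∀ x, Torus.partialDeriv i (fun y => ⟪u y, Torus.gradient θ y⟫_ℝ) x *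
        Torus.partialDeriv i θ x =
        Torus.partialDeriv i θ x * ⟪u x, Torus.gradient (Torus.partialDeriv i θ) x⟫_ℝ +
          Torus.partialDeriv i θ x * ⟪Torus.partialDeriv i u x, Torus.gradient θ x⟫_ℝ := by
      intro x
      rw [Torus.partialDeriv_inner hu1 hg1, partialDeriv_gradient_comm hθ i x]
      ring
    have i1 : Integrable (fun x => Torus.partialDeriv i θ x *
        ⟪u x, Torus.gradient (Torus.partialDeriv i θ) x⟫_ℝ) volume :=
      ((hD i).smul' (hu.inner (hD i).gradient)).integrable
    have i2 : Integrable (fun x => Torus.partialDeriv i θ x *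
        ⟪Torus.partialDeriv i u x, Torus.gradient θ x⟫_ℝ) volume :=
      ((hD i).smul' ((hu.partialDeriv i).inner hg)).integrable
    simp_rw [hpt]
    rw [integral_add i1 i2, Torus.integral_mul_inner_gradient_self_eq_zero hu hdiv (hD i), zero_add]
  -- pointwise: `⟪∇θ, Du ∇θ⟫ = ∑ᵢ ∂ᵢθ ⟪∂ᵢu, ∇θ⟫`
  have hpt2 : ∀ x, ⟪Torus.gradient θ x, Torus.fderiv u x (Torus.gradient θ x)⟫_ℝ =
      ∑ i, Torus.partialDeriv i θ x * ⟪Torus.partialDeriv i u x, Torus.gradient θ x⟫_ℝ := by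
    intro x
    rw [Torus.fderiv_apply_eq_sum_partialDeriv hu1, inner_sum]
    refine Finset.sum_congr rfl fun i _ => ?_
    rw [real_inner_smul_right, Torus.gradient_apply hθ1, real_inner_comm]
  have i3 : ∀ i, Integrable (fun x => Torus.partialDeriv i θ x *
      ⟪Torus.partialDeriv i u x, Torus.gradient θ x⟫_ℝ) volume := fun i =>
    ((hD i).smul' ((hu.partialDeriv i).inner hg)).integrable
  simp_rw [hpt2]
  rw [integral_finsetSum _ fun i _ => i3 i]
  exact Finset.sum_congr rfl fun i _ => hterm i

/-! ## The `H¹` balance of classical passive scalars -/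

section Balance

variable {a b κ : ℝ} {u : ℝ → UnitAddTorus d → EuclideanSpace ℝ d} {φ : ℝ → UnitAddTorus d → ℝ}

/-- **The `H¹` balance.** For a classical solution of `∂ₜφ + u·∇φ = κΔφ`, `div u = 0` on
`[a, b] × T^d`, `a < b`, and every `t ∈ [a, b]`,
`d/dt ‖∇φ(t)‖²_{L²} = -2κ ∫ (Δφ(t))² - 2 ∫ ⟪∇φ(t), Du(t) ∇φ(t)⟫` as a one-sided derivative
within `[a, b]`: differentiate `∫ ∑ᵢ (∂ᵢφ)²` under the integral
(`IsSmoothSpaceTimeOn.hasDerivWithinAt_integral`), `∂ₜ∂ᵢ = ∂ᵢ∂ₜ`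
(`Torus.timeDerivWithin_partialDeriv_comm`), Green (`∑ᵢ ∫ ∂ᵢ∂ₜφ ∂ᵢφ = -∫ ∂ₜφ Δφ`), insert the
equation and use `integral_inner_gradient_mul_laplacian` (Miles–Doering 2018, §2, the
"`H¹` / mix-norm" balance; Poon 1996). [folklore] -/
theorem hasDerivWithinAt_scalarGradNormSq (hab : a < b)
    (h : Torus.IsClassicalScalarTransportOn (Icc a b) κ u φ) {t : ℝ} (ht : t ∈ Icc a b) :
    HasDerivWithinAt (fun s => Torus.scalarGradNormSq (φ s))
      (-(2 * κ) * (∫ x, Torus.laplacian (φ t) x ^ 2) -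
        2 * ∫ x, ⟪Torus.gradient (φ t) x, Torus.fderiv (u t) x (Torus.gradient (φ t) x)⟫_ℝ)
      (Icc a b) t := by
  set S : Set ℝ := Icc a b with hSdef
  have hSc : Convex ℝ S := convex_Icc a b
  have hU : UniqueDiffOn ℝ S := uniqueDiffOn_Icc hab
  have hφs : Torus.IsSmoothSpaceTimeOn S φ := h.smooth_scalar
  have hφt : Torus.IsSmooth (φ t) := hφs.isSmooth_slice ht
  have hut : Torus.IsSmooth (u t) := h.smooth_velocity.isSmooth_slice ht
  have hA : Torus.IsSmooth (Torus.timeDerivWithin S φ t) := hφs.isSmooth_timeDerivWithin hU ht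
  have hDi : ∀ i, Torus.IsSmoothSpaceTimeOn S (fun s => Torus.partialDeriv i (φ s)) :=
    fun i => hφs.partialDeriv hU i
  -- Step 1: differentiate `∫ ∑ᵢ (∂ᵢφ)²` under the integral sign.
  have hΦ : Torus.IsSmoothSpaceTimeOn S
      (fun s x => ∑ i, Torus.partialDeriv i (φ s) x * Torus.partialDeriv i (φ s) x) :=
    Torus.IsSmoothSpaceTimeOn.sum fun i _ => (hDi i).mul (hDi i)
  have hE := hΦ.hasDerivWithinAt_integral hSc ht
  -- Step 2: `∂ₜ ∑ᵢ (∂ᵢφ)² = 2 ∑ᵢ ∂ᵢ∂ₜφ ∂ᵢφ`.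
  have htd : ∀ x, Torus.timeDerivWithin S
      (fun s x => ∑ i, Torus.partialDeriv i (φ s) x * Torus.partialDeriv i (φ s) x) t x =
      2 * ∑ i, Torus.partialDeriv i (Torus.timeDerivWithin S φ t) x * Torus.partialDeriv i (φ t) x := by
    intro x
    rw [Torus.timeDerivWithin_finset_sum Finset.univ (fun i _ => (hDi i).mul (hDi i)) hU ht x,
      Finset.mul_sum]
    refine Finset.sum_congr rfl fun i _ => ?_
    have h2 : HasDerivWithinAt (fun τ => Torus.partialDeriv i (φ τ) x * Torus.partialDeriv i (φ τ) x)
        (Torus.timeDerivWithin S (fun s => Torus.partialDeriv i (φ s)) t x * Torus.partialDeriv i (φ t) x +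
          Torus.partialDeriv i (φ t) x * Torus.timeDerivWithin S (fun s => Torus.partialDeriv i (φ s)) t x)
        S t :=
      ((hDi i).hasDerivWithinAt_slice ht x).mul ((hDi i).hasDerivWithinAt_slice ht x)
    rw [Torus.timeDerivWithin, h2.derivWithin (hU t ht),
      Torus.timeDerivWithin_partialDeriv_comm hab hφs ht i x]
    ring
  -- Step 3: Green, `∑ᵢ ∫ ∂ᵢ∂ₜφ ∂ᵢφ = -∫ ∂ₜφ Δφ`.
  have hE' : ∫ x, Torus.timeDerivWithin S
        (fun s x => ∑ i, Torus.partialDeriv i (φ s) x * Torus.partialDeriv i (φ s) x) t x =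
      -2 * ∫ x, Torus.timeDerivWithin S φ t x * Torus.laplacian (φ t) x := by
    have hAi : ∀ i, Integrable (fun x => Torus.partialDeriv i (Torus.timeDerivWithin S φ t) x *
        Torus.partialDeriv i (φ t) x) volume := fun i =>
      ((hA.partialDeriv i).smul' (hφt.partialDeriv i)).integrable
    simp_rw [htd]
    rw [integral_const_mul, integral_finsetSum _ fun i _ => hAi i,
      Torus.integral_mul_laplacian_eq_neg_sum hA hφt]
    ring
  rw [hE'] at hE
  -- Step 4: insert the equation `∂ₜφ = κΔφ - ⟪u, ∇φ⟫`.
  have hval : ∫ x, Torus.timeDerivWithin S φ t x * Torus.laplacian (φ t) x =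
      κ * (∫ x, Torus.laplacian (φ t) x ^ 2) +
        ∫ x, ⟪Torus.gradient (φ t) x, Torus.fderiv (u t) x (Torus.gradient (φ t) x)⟫_ℝ := by
    have hpt : ∀ x, Torus.timeDerivWithin S φ t x * Torus.laplacian (φ t) x =
        κ * Torus.laplacian (φ t) x ^ 2 -
          ⟪u t x, Torus.gradient (φ t) x⟫_ℝ * Torus.laplacian (φ t) x := by
      intro x
      have := h.transport t ht x
      have hre : Torus.timeDerivWithin S φ t x =
          κ * Torus.laplacian (φ t) x - ⟪u t x, Torus.gradient (φ t) x⟫_ℝ := by linarith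
      rw [hre]
      ring
    have i1 : Integrable (fun x => κ * Torus.laplacian (φ t) x ^ 2) volume :=
      (continuous_const.mul (hφt.laplacian.continuous.pow 2)).integrable_unitAddTorus
    have i2 : Integrable (fun x => ⟪u t x, Torus.gradient (φ t) x⟫_ℝ * Torus.laplacian (φ t) x) volume :=
      ((hut.inner hφt.gradient).smul' hφt.laplacian).integrable
    simp_rw [hpt]
    rw [integral_sub i1 i2, integral_const_mul,
      integral_inner_gradient_mul_laplacian hut (h.divFree t ht) hφt]
    ring
  rw [hval] at hE
  -- Step 5: `‖∇φ(s)‖²_{L²} = ∫ ∑ᵢ (∂ᵢφ(s))²` on `S`.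
  have hfun : ∀ s ∈ S, Torus.scalarGradNormSq (φ s) =
      ∫ x, ∑ i, Torus.partialDeriv i (φ s) x * Torus.partialDeriv i (φ s) x := by
    intro s hs
    rw [Torus.scalarGradNormSq]
    refine integral_congr_ae (ae_of_all _ fun x => ?_)
    dsimp only
    rw [Torus.norm_gradient_sq_eq_sum ((hφs.isSmooth_slice hs).isContDiff (by simp))]
    exact Finset.sum_congr rfl fun i _ => sq _
  have hfinal := hE.congr (fun s hs => hfun s hs) (hfun t ht)
  exact hfinal.congr_deriv (by ring)

/-- Continuity of the scalar enstrophy `t ↦ ‖∇φ(t)‖²_{L²}` on `[a, b]` (`a < b`). [folklore] -/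
theorem continuousOn_scalarGradNormSq (hab : a < b)
    (h : Torus.IsClassicalScalarTransportOn (Icc a b) κ u φ) :
    ContinuousOn (fun s => Torus.scalarGradNormSq (φ s)) (Icc a b) :=
  fun _ hs => (hasDerivWithinAt_scalarGradNormSq hab h hs).continuousWithinAt

/-! ## The gradient-growth bound -/

/-- **Gradient growth of releases (Poon 1996 / Miles–Doering 2018).** For a classical solution
`φ` of `∂ₜφ + u·∇φ = κΔφ`, `div u = 0` on `[a, b] × T^d` (`κ ≥ 0`, `a < b`) whose drift
satisfies `|⟪ξ, Du(t, x) ξ⟫| ≤ Λ(t)‖ξ‖²` with `Λ` continuous on `[a, b]`,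
`‖∇φ(t)‖² ≤ ‖∇φ(a)‖² exp(2∫ₐᵗ Λ)` for `t ∈ [a, b]`: by the `H¹` balance
`E' = -2κ∫(Δφ)² - 2∫⟪∇φ, Du ∇φ⟫ ≤ 2ΛE`, so `t ↦ E(t) exp(-2∫ₐᵗ Λ)` is non-increasing
(Mathlib `antitoneOn_of_hasDerivWithinAt_nonpos`; `Λ` is first extended continuously to `ℝ`,
`Set.IccExtend`, to differentiate its primitive). [folklore] -/
theorem scalarGradNormSq_le_mul_exp {Λ : ℝ → ℝ} (hκ : 0 ≤ κ) (hab : a < b)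
    (h : Torus.IsClassicalScalarTransportOn (Icc a b) κ u φ) (hΛ : ContinuousOn Λ (Icc a b))
    (hΛb : ∀ t ∈ Icc a b, ∀ (x : UnitAddTorus d) (ξ : EuclideanSpace ℝ d),
      |⟪ξ, Torus.fderiv (u t) x ξ⟫_ℝ| ≤ Λ t * ‖ξ‖ ^ 2)
    {t : ℝ} (ht : t ∈ Icc a b) :
    Torus.scalarGradNormSq (φ t) ≤
      Torus.scalarGradNormSq (φ a) * Real.exp (2 * ∫ τ in a..t, Λ τ) := by
  set E : ℝ → ℝ := fun s => Torus.scalarGradNormSq (φ s) with hE_def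
  set D : ℝ → ℝ := fun s => -(2 * κ) * (∫ x, Torus.laplacian (φ s) x ^ 2) -
    2 * ∫ x, ⟪Torus.gradient (φ s) x, Torus.fderiv (u s) x (Torus.gradient (φ s) x)⟫_ℝ with hD_def
  have hder : ∀ s ∈ Icc a b, HasDerivWithinAt E (D s) (Icc a b) s := fun s hs =>
    hasDerivWithinAt_scalarGradNormSq hab h hs
  -- the differential inequality `E' ≤ 2ΛE`
  have hbound : ∀ s ∈ Icc a b, D s ≤ 2 * Λ s * E s := by
    intro s hs
    have hφσ : Torus.IsSmooth (φ s) := h.smooth_scalar.isSmooth_slice hs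
    have huσ : Torus.IsSmooth (u s) := h.smooth_velocity.isSmooth_slice hs
    have hsm : Torus.IsSmooth (fun x =>
        ⟪Torus.gradient (φ s) x, Torus.fderiv (u s) x (Torus.gradient (φ s) x)⟫_ℝ) :=
      hφσ.gradient.inner (hφσ.gradient.convect huσ)
    have h1 : 0 ≤ 2 * κ * ∫ x, Torus.laplacian (φ s) x ^ 2 :=
      mul_nonneg (mul_nonneg two_pos.le hκ) (integral_nonneg fun x => sq_nonneg _)
    have h2 : |∫ x, ⟪Torus.gradient (φ s) x, Torus.fderiv (u s) x (Torus.gradient (φ s) x)⟫_ℝ| ≤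
        Λ s * E s := by
      calc |∫ x, ⟪Torus.gradient (φ s) x, Torus.fderiv (u s) x (Torus.gradient (φ s) x)⟫_ℝ|
          ≤ ∫ x, |⟪Torus.gradient (φ s) x, Torus.fderiv (u s) x (Torus.gradient (φ s) x)⟫_ℝ| :=
            abs_integral_le_integral_abs
        _ ≤ ∫ x, Λ s * ‖Torus.gradient (φ s) x‖ ^ 2 :=
            integral_mono hsm.integrable.abs (hφσ.gradient.norm_sq.integrable.const_mul (Λ s))
              fun x => hΛb s hs x _
        _ = Λ s * E s := integral_const_mul _ _
    have h3 := neg_abs_le (∫ x, ⟪Torus.gradient (φ s) x, Torus.fderiv (u s) x (Torus.gradient (φ s) x)⟫_ℝ)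
    simp only [hD_def]
    linarith
  -- a continuous extension of `Λ` to `ℝ` and its primitive
  set Λ' : ℝ → ℝ := IccExtend hab.le ((Icc a b).restrict Λ) with hΛ'_def
  have hΛ'c : Continuous Λ' := (hΛ.restrict).Icc_extend'
  have hΛ'eq : ∀ τ ∈ Icc a b, Λ' τ = Λ τ := fun τ hτ => by
    rw [hΛ'_def, IccExtend_of_mem _ _ hτ]
    rfl
  have hP : ∀ s, HasDerivAt (fun r => ∫ τ in a..r, Λ' τ) (Λ' s) s := fun s =>
    (hΛ'c.integral_hasStrictDerivAt a s).hasDerivAt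
  have hPeq : ∀ s ∈ Icc a b, ∫ τ in a..s, Λ' τ = ∫ τ in a..s, Λ τ := by
    intro s hs
    refine intervalIntegral.integral_congr fun τ hτ => hΛ'eq τ ?_
    rw [uIcc_of_le hs.1] at hτ
    exact ⟨hτ.1, hτ.2.trans hs.2⟩
  -- `G = E · exp(-2 ∫ₐ Λ')` is non-increasing on `[a, b]`
  set G : ℝ → ℝ := fun s => E s * Real.exp (-2 * ∫ τ in a..s, Λ' τ) with hG_def
  have hEcont : ContinuousOn E (Icc a b) := fun s hs => (hder s hs).continuousWithinAt
  have hPc : Continuous fun s => -2 * ∫ τ in a..s, Λ' τ :=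
    continuous_const.mul (continuous_iff_continuousAt.2 fun s => (hP s).continuousAt)
  have hGcont : ContinuousOn G (Icc a b) := hEcont.mul hPc.rexp.continuousOn
  have hGder : ∀ x ∈ interior (Icc a b), HasDerivWithinAt G
      (D x * Real.exp (-2 * ∫ τ in a..x, Λ' τ) +
        E x * (Real.exp (-2 * ∫ τ in a..x, Λ' τ) * (-2 * Λ' x))) (interior (Icc a b)) x := by
    intro x hx
    rw [interior_Icc] at hx ⊢
    have hxI : x ∈ Icc a b := Ioo_subset_Icc_self hx
    have h1 : HasDerivWithinAt (fun s => -2 * ∫ τ in a..s, Λ' τ) (-2 * Λ' x) (Icc a b) x :=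
      ((hP x).hasDerivWithinAt).const_mul (-2)
    exact ((hder x hxI).mul h1.exp).mono Ioo_subset_Icc_self
  have hGnonpos : ∀ x ∈ interior (Icc a b),
      D x * Real.exp (-2 * ∫ τ in a..x, Λ' τ) +
        E x * (Real.exp (-2 * ∫ τ in a..x, Λ' τ) * (-2 * Λ' x)) ≤ 0 := by
    intro x hx
    rw [interior_Icc] at hx
    have hxI : x ∈ Icc a b := Ioo_subset_Icc_self hx
    have hb := hbound x hxI
    have hexp : 0 < Real.exp (-2 * ∫ τ in a..x, Λ' τ) := Real.exp_pos _
    rw [hΛ'eq x hxI]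
    have hre : D x * Real.exp (-2 * ∫ τ in a..x, Λ' τ) +
        E x * (Real.exp (-2 * ∫ τ in a..x, Λ' τ) * (-2 * Λ x)) =
        Real.exp (-2 * ∫ τ in a..x, Λ' τ) * (D x - 2 * Λ x * E x) := by ring
    rw [hre]
    nlinarith
  have hanti := antitoneOn_of_hasDerivWithinAt_nonpos (convex_Icc a b) hGcont hGder hGnonpos
  have hle : G t ≤ G a := hanti (left_mem_Icc.2 hab.le) ht ht.1
  have hGa : G a = E a := by
    simp only [hG_def, intervalIntegral.integral_same, mul_zero, Real.exp_zero, mul_one]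
  rw [hGa] at hle
  have hGt : G t = E t * Real.exp (-2 * ∫ τ in a..t, Λ τ) := by
    simp only [hG_def, hPeq t ht]
  rw [hGt] at hle
  have hpos : 0 < Real.exp (2 * ∫ τ in a..t, Λ τ) := Real.exp_pos _
  have hmul := mul_le_mul_of_nonneg_right hle hpos.le
  rw [mul_assoc, ← Real.exp_add, show -2 * (∫ τ in a..t, Λ τ) + 2 * ∫ τ in a..t, Λ τ = 0 by ring,
    Real.exp_zero, mul_one] at hmul
  exact hmul

end Balance

/-! ## Registered form -/

/-- **Tool stub `stub_releaseGradientGrowth`** (Poon / Miles–Doering gradient-growth bound,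
registered sub-goal of stmt-AnomalousDissipation-0448 for the line `budgeted-mixer-template`):
for a classical solution `φ` of `∂ₜφ + u·∇φ = κΔφ` (`κ ≥ 0`) on `[a, b] × T²` over a smooth
divergence-free drift whose velocity gradient is bounded by `Λ(t)` in quadratic form,
`‖∇φ(t)‖² ≤ ‖∇φ(a)‖² · exp(2 ∫ₐᵗ Λ)` (`scalarGradNormSq_le_mul_exp`). [folklore] -/
theorem stub_releaseGradientGrowth :
    ∀ (κ a b : ℝ) (u : ℝ → UnitAddTorus (Fin 2) → EuclideanSpace ℝ (Fin 2))
      (φ : ℝ → UnitAddTorus (Fin 2) → ℝ) (Λ : ℝ → ℝ),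
      0 ≤ κ → a < b →
      Torus.IsClassicalScalarTransportOn (Set.Icc a b) κ u φ →
      ContinuousOn Λ (Set.Icc a b) →
      (∀ t ∈ Set.Icc a b, ∀ (x : UnitAddTorus (Fin 2)) (ξ : EuclideanSpace ℝ (Fin 2)),
          |inner ℝ ξ (Torus.fderiv (u t) x ξ)| ≤ Λ t * ‖ξ‖ ^ 2) →
      ∀ t ∈ Set.Icc a b,
        Torus.scalarGradNormSq (φ t) ≤ Torus.scalarGradNormSq (φ a) * Real.exp (2 * ∫ τ in a..t, Λ τ) :=
  fun _ _ _ _ _ _ hκ hab hφ hΛ hΛb _ ht => scalarGradNormSq_le_mul_exp hκ hab hφ hΛ hΛb ht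

end Summit.AnomalousDissipation.AnomalousDissipation.Theorems.ScalarAnomalySteadySourceFormal.ReleaseGradientGrowth

end
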